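import Summits.CriticalPhenomena.CardyFormulaZ2.Theorems.CardyFlipRussoVoronoiHubFromSmirnovOneArmDefs
import Mathlib.Analysis.SpecialFunctions.Pow.Asymptotics
import Mathlib.Analysis.SpecialFunctions.Pow.Continuity
import Mathlib.Analysis.SpecialFunctions.Log.Basic
import HarnessLib

/-!
# Stub `tendsto_const_mul_log_pow_mul_rpow` of line `moebius-exact-delaunay-dilation-ward`
# (crux `VoronoiHubFromSmirnov`, stmt-CriticalPhenomena-6433)

Bookkeeping limit for the final summation of the one-arm route: every error term there is a
constant times a power of `|log δ|` times a positive power of `δ`, and each such term tends to `0`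
as the mesh `δ → 0⁺`:

* `tendsto_const_mul_log_pow_mul_rpow` — `C * |log δ| ^ k * δ ^ s → 0` as `δ → 0⁺`, for every
  `C : ℝ`, `k : ℕ` and `s > 0`.

Proof: for `k = 0` this is continuity of `δ ↦ δ ^ s` at `0` (`Real.continuousAt_rpow_const`,
`Real.zero_rpow`); for `k ≠ 0` and `δ > 0` one has
`|log δ| ^ k * δ ^ s = |log δ * δ ^ (s / k)| ^ k` (`Real.rpow_natCast`, `Real.rpow_mul`), and
`log δ * δ ^ r → 0` for `r > 0` is Mathlib's `tendsto_log_mul_rpow_nhdsGT_zero`; then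
`Filter.Tendsto.abs`, `Filter.Tendsto.pow`, `Filter.Tendsto.const_mul`.  Elementary real analysis
(Mathlib only); no new definitions, no named facts.
-/

noncomputable section

namespace Summit.CriticalPhenomena.CardyFormulaZ2.Cruxes.VoronoiHubFromSmirnov.MoebiusExactDelaunayDilationWard

open Filter
open scoped Topology

/-- `|log δ| ^ k * δ ^ s → 0` as `δ → 0⁺`, for every `k : ℕ` and `s > 0` (polylogarithms lose
against positive powers; from Mathlib's `tendsto_log_mul_rpow_nhdsGT_zero`). -/
theorem tendsto_abs_log_pow_mul_rpow_nhdsGT_zero (s : ℝ) (k : ℕ) (hs : 0 < s) :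
    Tendsto (fun δ : ℝ => |Real.log δ| ^ k * δ ^ s) (𝓝[>] 0) (𝓝 0) := by
  rcases Nat.eq_zero_or_pos k with rfl | hk
  · simp only [pow_zero, one_mul]
    have h := (Real.continuousAt_rpow_const 0 s (Or.inr hs.le)).tendsto
    rw [Real.zero_rpow hs.ne'] at h
    exact tendsto_nhdsWithin_of_tendsto_nhds h
  have hk' : (k : ℝ) ≠ 0 := Nat.cast_ne_zero.mpr hk.ne'
  have h := ((tendsto_log_mul_rpow_nhdsGT_zero (r := s / k) (by positivity)).abs).pow k
  rw [abs_zero, zero_pow hk.ne'] at h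
  refine h.congr' ?_
  filter_upwards [self_mem_nhdsWithin] with δ (hδ : 0 < δ)
  rw [abs_mul, abs_of_nonneg (Real.rpow_nonneg hδ.le _), mul_pow,
    ← Real.rpow_natCast (δ ^ (s / k)) k, ← Real.rpow_mul hδ.le, div_mul_cancel₀ s hk']

/-- **Bookkeeping limit of the one-arm route** (registered stub of the crux):
`C * |log δ| ^ k * δ ^ s → 0` as `δ → 0⁺`, for every real constant `C`, every `k : ℕ` and every
exponent `s > 0`. -/
theorem tendsto_const_mul_log_pow_mul_rpow : ∀ (C s : ℝ) (k : ℕ), 0 < s → Filter.Tendsto (fun δ : ℝ => C * |Real.log δ| ^ k * δ ^ s) (nhdsWithin 0 (Set.Ioi 0)) (nhds 0) := by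
  intro C s k hs
  have h := (tendsto_abs_log_pow_mul_rpow_nhdsGT_zero s k hs).const_mul C
  rw [mul_zero] at h
  exact h.congr fun δ => (mul_assoc C (|Real.log δ| ^ k) (δ ^ s)).symm

end Summit.CriticalPhenomena.CardyFormulaZ2.Cruxes.VoronoiHubFromSmirnov.MoebiusExactDelaunayDilationWard

end
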